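import Summits.CriticalPhenomena.LaceExpansionHighD.WeightSplitDrift
import HarnessLib

/-!
# The diagram-level weight split "LEMMA J", layer B: the `N = 1` cross-term sign (cell pub-lace7, Lean seat 3)

PROGRAMME-INTERNAL (no printed counterpart; NOT CITABLE as literature).  Continues `WeightSplitDrift` (layer A).  Context:
[FvdH17]-ext proof of Lemma `lemmapercboundXi1`, (BoundNOne) `‖x‖₂² ≤ 3(‖w‖₂² + ‖z−w‖₂² + ‖x−z‖₂²)` (Cauchy–Schwarz, `J = 3`);
`b2b-lace` packet `carver/g8/LEMMA-J.md` Thm 3 (i): for the generic `N = 1` bounding diagram (left triangle with exchangeable legs ·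
square whose top rail is a pivotal bond followed by an even line and whose bottom rail is the same even line · right triangle with
exchangeable legs; rung weights arbitrary) the cross term of the split `x = Δ₁ + Δ₂ + Δ₃` is `≤ 0` for EVERY rung configuration, so
`Σ‖x‖²F ≤ Σ_k Σ‖Δ_k‖²F` (`J = 1`).

## Layer B1 (this file, first instalment): the pointwise sign lemma, LEMMA-J (4.1) + (K)

After the block drifts of layer A are inserted (left leg `E[Δ₁ | r₀] = −r₀/2`, bottom rail `E[Δ₂ | s, e] = −(s − e)/2`, right leg
`E[Δ₃ | r₁] = r₁/2`, `r₁ = r₀ + s`, bond `e` with weight `λ_e = κ(e)·A(s − e) ≥ 0`, `|e| ≤ 1`), the cross term at rung data `(r₀, s)` is,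
up to the non-negative factor `ρ₀(r₀) G_L(r₀) ρ₁(r₁) G_R(r₁) / 2`,
`cross(r₀, s) = W(s)·(−|r₀|² − |s|² − ⟨r₀, s⟩) + ⟨s, N(s)⟩`, `W(s) = Σ_e λ_e`, `N(s) = Σ_e λ_e e`.
`cross_sign_le_zero` proves `cross(r₀, s) ≤ 0` for all `r₀, s ∈ ℤ^d` from `sq_sum_drift_le` (`|N| ≤ W`) and `crossKernel_of_drift`
(the integrality kernel (K) of `WeightSplitCrossTerm`).  Layer B2 (the 3-block chain assembly in displacement coordinates, i.e. the
passage from the six-fold diagram sum to `Σ_{r₀,s} [square terms] + [factor]·cross(r₀,s)`) is NOT in this instalment.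

HONEST FRAMING: elementary real algebra over `ℤ^d`; no percolation object; no dimension sentence.
-/

noncomputable section

namespace Summit.CriticalPhenomena.LaceExpansionHighD.WeightSplit

open Finset
open scoped BigOperators

variable {d : ℕ}

/-- **The `N = 1` cross term is non-positive, rung configuration by rung configuration** (LEMMA-J (4.1) with the kernel (K)).
For a finite set `E ⊆ ℤ^d` of bond vectors of Euclidean length `≤ 1`, non-negative bond weights `κ`, a non-negative function `A`
(the equal-rail mass `A(q) = Σ_b g(b + q) g(b)` of the square at rail discrepancy `q`), and rung data `r₀, s ∈ ℤ^d`
(`s = r₁ − r₀`), with `λ_e = κ(e) A(s − e)`, `W = Σ_e λ_e`, `N_i = Σ_e λ_e e_i`: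
`W · (−|r₀|² − |s|² − ⟨r₀, s⟩) + ⟨s, N⟩ ≤ 0`. -/
theorem cross_sign_le_zero (E : Finset (Fin d → ℤ)) (hE : ∀ e ∈ E, ∑ i, ((e i : ℤ) : ℝ) ^ 2 ≤ 1)
    (κ A : (Fin d → ℤ) → ℝ) (hκ : ∀ e ∈ E, 0 ≤ κ e) (hA : ∀ q, 0 ≤ A q) (r₀ s : Fin d → ℤ) :
    (∑ e ∈ E, κ e * A (s - e)) *
        (-(∑ i, ((r₀ i : ℝ)) ^ 2) - ∑ i, ((s i : ℝ)) ^ 2 - ∑ i, (r₀ i : ℝ) * (s i : ℝ)) +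
      ∑ i, (s i : ℝ) * (∑ e ∈ E, κ e * A (s - e) * (e i : ℝ)) ≤ 0 := by
  set lam : (Fin d → ℤ) → ℝ := fun e => κ e * A (s - e) with hlam
  have hlam0 : ∀ e ∈ E, 0 ≤ lam e := fun e he => mul_nonneg (hκ e he) (hA _)
  set W : ℝ := ∑ e ∈ E, lam e with hW
  set N : Fin d → ℝ := fun i => ∑ e ∈ E, lam e * (e i : ℝ) with hN
  have hW0 : 0 ≤ W := Finset.sum_nonneg hlam0
  -- |N| ≤ W (bond drift)
  have hNW : ∑ i, (N i) ^ 2 ≤ W ^ 2 := sq_sum_drift_le E hE lam hlam0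
  -- (K) with r₁ := r₀ + s
  have hK := crossKernel_of_drift r₀ (r₀ + s) N hW0 hNW
  have hsub : ∀ i, (((r₀ + s) i - r₀ i : ℤ) : ℝ) = (s i : ℝ) := by
    intro i; push_cast [Pi.add_apply]; ring
  have hadd : ∀ i, (((r₀ + s) i : ℤ) : ℝ) = (r₀ i : ℝ) + (s i : ℝ) := by
    intro i; push_cast [Pi.add_apply]; ring
  simp only [hsub, hadd] at hK
  -- rewrite the budget: |r₀|² + |r₀ + s|² + |s|² = 2(|r₀|² + ⟨r₀,s⟩ + |s|²)
  have hbudget : ∑ i, ((r₀ i : ℝ)) ^ 2 + ∑ i, ((r₀ i : ℝ) + (s i : ℝ)) ^ 2 + ∑ i, ((s i : ℝ)) ^ 2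
      = 2 * (∑ i, ((r₀ i : ℝ)) ^ 2 + ∑ i, (r₀ i : ℝ) * (s i : ℝ) + ∑ i, ((s i : ℝ)) ^ 2) := by
    simp only [← Finset.sum_add_distrib, Finset.mul_sum]
    exact Finset.sum_congr rfl fun i _ => by ring
  rw [hbudget] at hK
  -- the cross sum Σ s_i N_i equals Σ N_i s_i
  have hcomm : ∑ i, (s i : ℝ) * N i = ∑ i, N i * (s i : ℝ) := by
    refine Finset.sum_congr rfl fun i _ => ?_; ring
  have hgoal : W * (-(∑ i, ((r₀ i : ℝ)) ^ 2) - ∑ i, ((s i : ℝ)) ^ 2 - ∑ i, (r₀ i : ℝ) * (s i : ℝ))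
      + ∑ i, (s i : ℝ) * N i ≤ 0 := by
    rw [hcomm]; nlinarith [hK, hW0]
  simpa [hW, hN, hlam, Finset.sum_mul, mul_assoc] using hgoal


/-! ## Layer B2 (second instalment): the three-block chain assembly — LEMMA-J Thm 1 (three blocks) + Thm 3 (i)

In displacement coordinates `(r₀, s, e; w, b, c)` (left backbone leg `w`, `u = w + r₀`; bond `e`; bottom rail `b`, top τ-line
`a = b + s − e`, so `r₁ = r₀ + s`; right backbone leg `c`, other right leg `c − r₁`; endpoint `x = w + b + c`) the three blocks
`L(w) = gL(w+r₀)gL(w)`, `Q_e(b) = g(b+s−e)g(b)`, `R(c) = gR(c−r₁)gR(c)` are INDEPENDENT product factors at fixed rung data, so the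
six-fold diagram sum is `Σ_{r₀,s} ρ₀(r₀)ρ₁(r₀+s) Σ_e κ_e Σ'_{w,b,c} (…)·L Q_e R` and J-freeness is the statement, for EVERY `(r₀, s)`,
`Σ_e κ_e Σ'_{w,b,c} ‖w+b+c‖² L Q_e R ≤ Σ_e κ_e Σ'_{w,b,c} (‖w‖²+‖b‖²+‖c‖²) L Q_e R` — `chain3_weightSplit_le` below (finite-support version:
`gL, g, gR` vanish off finite sets, so every series is a finite sum; for summable two-point functions apply it to truncations and pass to
the monotone limit).  Tools: `tsum3_sep` (separable triple sums factorise — hypothesis-free), `tsum3_add` / `tsum3_finset_sum` (linearity in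
the integrand under finite support), `tsum3_sq_expand` / `tsum3_diag_expand` (second-moment expansion), the block drifts of layer A and
`cross_sign_le_zero`.  HONEST FRAMING: elementary; no percolation object; the identification of the engine's `N = 1` generic cell
(cases `a, b ≥ 1` of [FvdH17]-ext l.9926–9931) with this abstract diagram, and the boundary cases (ii)–(iv) of LEMMA-J Thm 3, are NOT in
this file. -/

/-! ### B2.1 Separable triple sums (hypothesis-free factorisation) -/

/-- `Σ'_w Σ'_b Σ'_c (A w · B b · C c)·(L w · Q b · R c) = (Σ' A·L)(Σ' B·Q)(Σ' C·R)` — no summability needed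
(`tsum_mul_left/right` hold unconditionally over `ℝ`). -/
theorem tsum3_sep (A B C L Q R : (Fin d → ℤ) → ℝ) :
    ∑' w, ∑' b, ∑' c, (A w * B b * C c) * (L w * Q b * R c)
      = (∑' w, A w * L w) * (∑' b, B b * Q b) * (∑' c, C c * R c) := by
  have h1 : ∀ w b, ∑' c, (A w * B b * C c) * (L w * Q b * R c)
      = (A w * L w) * (B b * Q b) * ∑' c, C c * R c := by
    intro w b
    rw [← tsum_mul_left]
    refine tsum_congr fun c => ?_
    ring
  have h2 : ∀ w, ∑' b, (A w * L w) * (B b * Q b) * ∑' c, C c * R c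
      = (A w * L w) * ((∑' b, B b * Q b) * ∑' c, C c * R c) := by
    intro w
    rw [← tsum_mul_right, ← tsum_mul_left]
    refine tsum_congr fun b => ?_
    ring
  simp_rw [h1, h2]
  rw [tsum_mul_right]
  ring

/-! ### B2.2 Summability from finite support, level by level -/

/-- A function vanishing off a finite set is summable. -/
theorem summable_of_vanish {f : (Fin d → ℤ) → ℝ} (S : Finset (Fin d → ℤ)) (h : ∀ x ∉ S, f x = 0) :
    Summable f :=
  summable_of_ne_finset_zero h

/-- Additivity of the weighted triple sum in the integrand, for block weights `L, Q, R` of finite support. -/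
theorem tsum3_add (L Q R : (Fin d → ℤ) → ℝ) {SL SQ SR : Finset (Fin d → ℤ)}
    (hL : ∀ x ∉ SL, L x = 0) (hQ : ∀ x ∉ SQ, Q x = 0) (hR : ∀ x ∉ SR, R x = 0)
    (φ ψ : (Fin d → ℤ) → (Fin d → ℤ) → (Fin d → ℤ) → ℝ) :
    ∑' w, ∑' b, ∑' c, (φ w b c + ψ w b c) * (L w * Q b * R c)
      = ∑' w, ∑' b, ∑' c, φ w b c * (L w * Q b * R c) + ∑' w, ∑' b, ∑' c, ψ w b c * (L w * Q b * R c) := by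
  -- generic vanishing facts
  have vc : ∀ (θ : (Fin d → ℤ) → (Fin d → ℤ) → (Fin d → ℤ) → ℝ) w b, ∀ c ∉ SR,
      θ w b c * (L w * Q b * R c) = 0 := by
    intro θ w b c hc; simp [hR c hc]
  have vb : ∀ (θ : (Fin d → ℤ) → (Fin d → ℤ) → (Fin d → ℤ) → ℝ) w, ∀ b ∉ SQ,
      ∑' c, θ w b c * (L w * Q b * R c) = 0 := by
    intro θ w b hb; simp [hQ b hb]
  have vw : ∀ (θ : (Fin d → ℤ) → (Fin d → ℤ) → (Fin d → ℤ) → ℝ), ∀ w ∉ SL,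
      ∑' b, ∑' c, θ w b c * (L w * Q b * R c) = 0 := by
    intro θ w hw; simp [hL w hw]
  have lc : ∀ w b, ∑' c, (φ w b c + ψ w b c) * (L w * Q b * R c)
      = ∑' c, φ w b c * (L w * Q b * R c) + ∑' c, ψ w b c * (L w * Q b * R c) := by
    intro w b
    rw [← (summable_of_vanish SR (vc φ w b)).tsum_add (summable_of_vanish SR (vc ψ w b))]
    refine tsum_congr fun c => ?_
    ring
  have lb : ∀ w, ∑' b, ∑' c, (φ w b c + ψ w b c) * (L w * Q b * R c)
      = ∑' b, ∑' c, φ w b c * (L w * Q b * R c) + ∑' b, ∑' c, ψ w b c * (L w * Q b * R c) := by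
    intro w
    simp_rw [lc]
    exact (summable_of_vanish SQ (vb φ w)).tsum_add (summable_of_vanish SQ (vb ψ w))
  simp_rw [lb]
  exact (summable_of_vanish SL (vw φ)).tsum_add (summable_of_vanish SL (vw ψ))

/-- Finite sums in the integrand commute with the weighted triple sum (block weights of finite support). -/
theorem tsum3_finset_sum {ι : Type*} (T : Finset ι) (L Q R : (Fin d → ℤ) → ℝ) {SL SQ SR : Finset (Fin d → ℤ)}
    (hL : ∀ x ∉ SL, L x = 0) (hQ : ∀ x ∉ SQ, Q x = 0) (hR : ∀ x ∉ SR, R x = 0)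
    (φ : ι → (Fin d → ℤ) → (Fin d → ℤ) → (Fin d → ℤ) → ℝ) :
    ∑' w, ∑' b, ∑' c, (∑ i ∈ T, φ i w b c) * (L w * Q b * R c)
      = ∑ i ∈ T, ∑' w, ∑' b, ∑' c, φ i w b c * (L w * Q b * R c) := by
  classical
  induction T using Finset.induction_on with
  | empty => simp
  | insert a T ha ih =>
    rw [Finset.sum_insert ha, ← ih, ← tsum3_add L Q R hL hQ hR]
    refine tsum_congr fun w => tsum_congr fun b => tsum_congr fun c => ?_
    rw [Finset.sum_insert ha]

/-! ### B2.3 The second-moment expansion of a separable triple sum -/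

/-- **Second-moment expansion.** For block weights `L, Q, R` of finite support and coordinate functions `α, β, γ`,
`Σ' (α w + β b + γ c)²·LQR = [Σ α²L]·A_Q·A_R + A_L·[Σ β²Q]·A_R + A_L·A_Q·[Σ γ²R]
  + 2([Σ αL][Σ βQ]A_R + [Σ αL]A_Q[Σ γR] + A_L[Σ βQ][Σ γR])` (`A_L = Σ' L` etc.). -/
theorem tsum3_sq_expand (L Q R : (Fin d → ℤ) → ℝ) {SL SQ SR : Finset (Fin d → ℤ)}
    (hL : ∀ x ∉ SL, L x = 0) (hQ : ∀ x ∉ SQ, Q x = 0) (hR : ∀ x ∉ SR, R x = 0) (α β γ : (Fin d → ℤ) → ℝ) :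
    ∑' w, ∑' b, ∑' c, (α w + β b + γ c) ^ 2 * (L w * Q b * R c)
      = (∑' w, α w ^ 2 * L w) * (∑' b, Q b) * (∑' c, R c)
        + (∑' w, L w) * (∑' b, β b ^ 2 * Q b) * (∑' c, R c)
        + (∑' w, L w) * (∑' b, Q b) * (∑' c, γ c ^ 2 * R c)
        + 2 * ((∑' w, α w * L w) * (∑' b, β b * Q b) * (∑' c, R c)
          + (∑' w, α w * L w) * (∑' b, Q b) * (∑' c, γ c * R c)
          + (∑' w, L w) * (∑' b, β b * Q b) * (∑' c, γ c * R c)) := by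
  -- pointwise: six separable terms
  have hpt : ∀ w b c, (α w + β b + γ c) ^ 2
      = α w ^ 2 * 1 * 1 + (1 * β b ^ 2 * 1 + (1 * 1 * γ c ^ 2
        + ((2 * α w) * β b * 1 + ((2 * α w) * 1 * γ c + 1 * (2 * β b) * γ c)))) := by
    intro w b c; ring
  simp_rw [hpt]
  rw [tsum3_add L Q R hL hQ hR, tsum3_add L Q R hL hQ hR, tsum3_add L Q R hL hQ hR, tsum3_add L Q R hL hQ hR,
    tsum3_add L Q R hL hQ hR]
  have t1 : ∑' w, ∑' b, ∑' c, (α w ^ 2 * 1 * 1) * (L w * Q b * R c)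
      = (∑' w, α w ^ 2 * L w) * (∑' b, 1 * Q b) * (∑' c, 1 * R c) :=
    tsum3_sep (fun w => α w ^ 2) (fun _ => 1) (fun _ => 1) L Q R
  have t2 : ∑' w, ∑' b, ∑' c, (1 * β b ^ 2 * 1) * (L w * Q b * R c)
      = (∑' w, 1 * L w) * (∑' b, β b ^ 2 * Q b) * (∑' c, 1 * R c) :=
    tsum3_sep (fun _ => 1) (fun b => β b ^ 2) (fun _ => 1) L Q R
  have t3 : ∑' w, ∑' b, ∑' c, (1 * 1 * γ c ^ 2) * (L w * Q b * R c)
      = (∑' w, 1 * L w) * (∑' b, 1 * Q b) * (∑' c, γ c ^ 2 * R c) :=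
    tsum3_sep (fun _ => 1) (fun _ => 1) (fun c => γ c ^ 2) L Q R
  have t4 : ∑' w, ∑' b, ∑' c, ((2 * α w) * β b * 1) * (L w * Q b * R c)
      = (∑' w, (2 * α w) * L w) * (∑' b, β b * Q b) * (∑' c, 1 * R c) :=
    tsum3_sep (fun w => 2 * α w) (fun b => β b) (fun _ => 1) L Q R
  have t5 : ∑' w, ∑' b, ∑' c, ((2 * α w) * 1 * γ c) * (L w * Q b * R c)
      = (∑' w, (2 * α w) * L w) * (∑' b, 1 * Q b) * (∑' c, γ c * R c) :=
    tsum3_sep (fun w => 2 * α w) (fun _ => 1) (fun c => γ c) L Q R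
  have t6 : ∑' w, ∑' b, ∑' c, (1 * (2 * β b) * γ c) * (L w * Q b * R c)
      = (∑' w, 1 * L w) * (∑' b, (2 * β b) * Q b) * (∑' c, γ c * R c) :=
    tsum3_sep (fun _ => 1) (fun b => 2 * β b) (fun c => γ c) L Q R
  rw [t1, t2, t3, t4, t5, t6]
  have s1 : ∑' w, (2 * α w) * L w = 2 * ∑' w, α w * L w := by
    rw [← tsum_mul_left]; exact tsum_congr fun w => by ring
  have s2 : ∑' b, (2 * β b) * Q b = 2 * ∑' b, β b * Q b := by
    rw [← tsum_mul_left]; exact tsum_congr fun b => by ring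
  simp only [one_mul, s1, s2]
  ring

/-- **Diagonal part.** `Σ' (α w² + β b² + γ c²)·LQR = [Σ α²L]A_Q A_R + A_L[Σ β²Q]A_R + A_L A_Q[Σ γ²R]`. -/
theorem tsum3_diag_expand (L Q R : (Fin d → ℤ) → ℝ) {SL SQ SR : Finset (Fin d → ℤ)}
    (hL : ∀ x ∉ SL, L x = 0) (hQ : ∀ x ∉ SQ, Q x = 0) (hR : ∀ x ∉ SR, R x = 0) (α β γ : (Fin d → ℤ) → ℝ) :
    ∑' w, ∑' b, ∑' c, (α w ^ 2 + β b ^ 2 + γ c ^ 2) * (L w * Q b * R c)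
      = (∑' w, α w ^ 2 * L w) * (∑' b, Q b) * (∑' c, R c)
        + (∑' w, L w) * (∑' b, β b ^ 2 * Q b) * (∑' c, R c)
        + (∑' w, L w) * (∑' b, Q b) * (∑' c, γ c ^ 2 * R c) := by
  have hpt : ∀ w b c, α w ^ 2 + β b ^ 2 + γ c ^ 2
      = α w ^ 2 * 1 * 1 + (1 * β b ^ 2 * 1 + 1 * 1 * γ c ^ 2) := by
    intro w b c; ring
  simp_rw [hpt]
  rw [tsum3_add L Q R hL hQ hR, tsum3_add L Q R hL hQ hR]
  have t1 : ∑' w, ∑' b, ∑' c, (α w ^ 2 * 1 * 1) * (L w * Q b * R c)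
      = (∑' w, α w ^ 2 * L w) * (∑' b, 1 * Q b) * (∑' c, 1 * R c) :=
    tsum3_sep (fun w => α w ^ 2) (fun _ => 1) (fun _ => 1) L Q R
  have t2 : ∑' w, ∑' b, ∑' c, (1 * β b ^ 2 * 1) * (L w * Q b * R c)
      = (∑' w, 1 * L w) * (∑' b, β b ^ 2 * Q b) * (∑' c, 1 * R c) :=
    tsum3_sep (fun _ => 1) (fun b => β b ^ 2) (fun _ => 1) L Q R
  have t3 : ∑' w, ∑' b, ∑' c, (1 * 1 * γ c ^ 2) * (L w * Q b * R c)
      = (∑' w, 1 * L w) * (∑' b, 1 * Q b) * (∑' c, γ c ^ 2 * R c) :=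
    tsum3_sep (fun _ => 1) (fun _ => 1) (fun c => γ c ^ 2) L Q R
  rw [t1, t2, t3]
  simp only [one_mul]
  ring

/-! ### B2.4 The main theorem: the three-block chain is J-free (LEMMA-J Thm 1 for three blocks + Thm 3 (i)) -/

/-- **The `N = 1` generic bounding diagram is J-free** (LEMMA-J Thm 3 (i), d-generic, diagram level).  Block weights on
`ℤ^d`: `gL, g, gR ≥ 0` EVEN and of finite support (the two legs of the left triangle, the two plain rails / the τ-line after the
pivotal bond, the two legs of the right triangle), bond weights `κ ≥ 0` on a finite set `E` of vectors of Euclidean length `≤ 1`,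
and ARBITRARY rung data `r₀, s ∈ ℤ^d` (the rung weights `ρ₀(r₀) ρ₁(r₀+s) ≥ 0` are constant at fixed rung data and are omitted).
In displacement coordinates (`w` = left backbone leg, `u = w + r₀`; bond `e`; bottom rail `b`, top τ-line `a = b + s − e`;
right backbone leg `c`, other right leg `c − (r₀ + s)`; `x = w + b + c`):
`Σ_e κ_e Σ'_{w,b,c} ‖w + b + c‖² · gL(w+r₀)gL(w) · g(b+s−e)g(b) · gR(c−r₀−s)gR(c)
   ≤ Σ_e κ_e Σ'_{w,b,c} (‖w‖² + ‖b‖² + ‖c‖²) · (same weight)` —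
i.e. the Cauchy–Schwarz factor `J = 3` of [FvdH17]-ext (BoundNOne) is `1` for this diagram, rung configuration by rung configuration.
Proof: second-moment expansion (`tsum3_sq_expand`), the block drifts of layer A (`tsum_coord_mul_shift_eq`: `−r₀/2`, `−(s−e)/2`,
`(r₀+s)/2`) and the sign lemma `cross_sign_le_zero` (layer B1). -/
theorem chain3_weightSplit_le (E : Finset (Fin d → ℤ)) (hE : ∀ e ∈ E, ∑ i, ((e i : ℤ) : ℝ) ^ 2 ≤ 1)
    (κ : (Fin d → ℤ) → ℝ) (hκ : ∀ e ∈ E, 0 ≤ κ e)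
    (gL g gR : (Fin d → ℤ) → ℝ) (hL0 : ∀ x, 0 ≤ gL x) (hg0 : ∀ x, 0 ≤ g x) (hR0 : ∀ x, 0 ≤ gR x)
    (hLe : Function.Even gL) (hge : Function.Even g) (hRe : Function.Even gR)
    (SL Sg SR : Finset (Fin d → ℤ)) (hSL : ∀ x ∉ SL, gL x = 0) (hSg : ∀ x ∉ Sg, g x = 0) (hSR : ∀ x ∉ SR, gR x = 0)
    (r₀ s : Fin d → ℤ) :
    ∑ e ∈ E, κ e * ∑' w, ∑' b, ∑' c, (∑ i, ((w i : ℝ) + (b i : ℝ) + (c i : ℝ)) ^ 2)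
        * ((gL (w + r₀) * gL w) * (g (b + (s - e)) * g b) * (gR (c + -(r₀ + s)) * gR c))
      ≤ ∑ e ∈ E, κ e * ∑' w, ∑' b, ∑' c, (∑ i, ((w i : ℝ)) ^ 2 + ∑ i, ((b i : ℝ)) ^ 2 + ∑ i, ((c i : ℝ)) ^ 2)
        * ((gL (w + r₀) * gL w) * (g (b + (s - e)) * g b) * (gR (c + -(r₀ + s)) * gR c)) := by
  -- supports of the three block weights
  have hLs : ∀ x ∉ SL, gL (x + r₀) * gL x = 0 := fun x hx => by simp [hSL x hx]
  have hRs : ∀ x ∉ SR, gR (x + -(r₀ + s)) * gR x = 0 := fun x hx => by simp [hSR x hx]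
  have hQs : ∀ e : Fin d → ℤ, ∀ x ∉ Sg, g (x + (s - e)) * g x = 0 := fun e x hx => by simp [hSg x hx]
  have sumv : ∀ (f : (Fin d → ℤ) → ℝ) (S : Finset (Fin d → ℤ)), (∀ x ∉ S, f x = 0) →
      ∀ (φ : (Fin d → ℤ) → ℝ), Summable fun x => φ x * f x := by
    intro f S hf φ
    exact summable_of_ne_finset_zero (s := S) fun x hx => by simp [hf x hx]
  -- block masses are non-negative
  have hAL0 : 0 ≤ ∑' w, gL (w + r₀) * gL w := tsum_nonneg fun w => mul_nonneg (hL0 _) (hL0 _)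
  have hAR0 : 0 ≤ ∑' c, gR (c + -(r₀ + s)) * gR c := tsum_nonneg fun c => mul_nonneg (hR0 _) (hR0 _)
  have hA0 : ∀ q : Fin d → ℤ, 0 ≤ ∑' b, g (b + q) * g b := fun q => tsum_nonneg fun b => mul_nonneg (hg0 _) (hg0 _)
  -- block drifts (layer A)
  have hML : ∀ i, ∑' w, (w i : ℝ) * (gL (w + r₀) * gL w) = -((r₀ i : ℝ) / 2) * ∑' w, gL (w + r₀) * gL w :=
    fun i => tsum_coord_mul_shift_eq gL hLe r₀ i (sumv _ SL hLs _) (summable_of_ne_finset_zero hLs)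
  have hMR : ∀ i, ∑' c, (c i : ℝ) * (gR (c + -(r₀ + s)) * gR c)
      = (((r₀ i : ℝ) + (s i : ℝ)) / 2) * ∑' c, gR (c + -(r₀ + s)) * gR c := by
    intro i
    have h := tsum_coord_mul_shift_eq gR hRe (-(r₀ + s)) i (sumv _ SR hRs _) (summable_of_ne_finset_zero hRs)
    have e1 : (((-(r₀ + s)) i : ℤ) : ℝ) = -((r₀ i : ℝ) + (s i : ℝ)) := by simp [Pi.neg_apply, Pi.add_apply]
    rw [e1, neg_div, neg_neg] at h
    exact h
  have hMQ : ∀ (e : Fin d → ℤ) (i : Fin d), ∑' b, (b i : ℝ) * (g (b + (s - e)) * g b)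
      = -(((s i : ℝ) - (e i : ℝ)) / 2) * ∑' b, g (b + (s - e)) * g b := by
    intro e i
    have h := tsum_coord_mul_shift_eq g hge (s - e) i (sumv _ Sg (hQs e) _) (summable_of_ne_finset_zero (hQs e))
    have e1 : (((s - e) i : ℤ) : ℝ) = (s i : ℝ) - (e i : ℝ) := by simp [Pi.sub_apply]
    rw [e1] at h
    exact h
  -- per-e expansions of the two integrands
  have hT : ∀ e : Fin d → ℤ,
      ∑' w, ∑' b, ∑' c, (∑ i, ((w i : ℝ) + (b i : ℝ) + (c i : ℝ)) ^ 2)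
        * ((gL (w + r₀) * gL w) * (g (b + (s - e)) * g b) * (gR (c + -(r₀ + s)) * gR c))
      = ∑ i, ((∑' w, (w i : ℝ) ^ 2 * (gL (w + r₀) * gL w)) * (∑' b, g (b + (s - e)) * g b)
            * (∑' c, gR (c + -(r₀ + s)) * gR c)
          + (∑' w, gL (w + r₀) * gL w) * (∑' b, (b i : ℝ) ^ 2 * (g (b + (s - e)) * g b))
            * (∑' c, gR (c + -(r₀ + s)) * gR c)
          + (∑' w, gL (w + r₀) * gL w) * (∑' b, g (b + (s - e)) * g b)
            * (∑' c, (c i : ℝ) ^ 2 * (gR (c + -(r₀ + s)) * gR c))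
          + 2 * ((-((r₀ i : ℝ) / 2) * ∑' w, gL (w + r₀) * gL w)
                  * (-(((s i : ℝ) - (e i : ℝ)) / 2) * ∑' b, g (b + (s - e)) * g b)
                  * (∑' c, gR (c + -(r₀ + s)) * gR c)
                + (-((r₀ i : ℝ) / 2) * ∑' w, gL (w + r₀) * gL w) * (∑' b, g (b + (s - e)) * g b)
                  * ((((r₀ i : ℝ) + (s i : ℝ)) / 2) * ∑' c, gR (c + -(r₀ + s)) * gR c)
                + (∑' w, gL (w + r₀) * gL w) * (-(((s i : ℝ) - (e i : ℝ)) / 2) * ∑' b, g (b + (s - e)) * g b)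
                  * ((((r₀ i : ℝ) + (s i : ℝ)) / 2) * ∑' c, gR (c + -(r₀ + s)) * gR c))) := by
    intro e
    have h1 := tsum3_finset_sum Finset.univ (fun w => gL (w + r₀) * gL w) (fun b => g (b + (s - e)) * g b)
      (fun c => gR (c + -(r₀ + s)) * gR c) hLs (hQs e) hRs
      (fun (i : Fin d) (w b c : Fin d → ℤ) => ((w i : ℝ) + (b i : ℝ) + (c i : ℝ)) ^ 2)
    beta_reduce at h1
    rw [h1]
    refine Finset.sum_congr rfl fun i _ => ?_
    have h2 := tsum3_sq_expand (fun w => gL (w + r₀) * gL w) (fun b => g (b + (s - e)) * g b)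
      (fun c => gR (c + -(r₀ + s)) * gR c) hLs (hQs e) hRs (fun w => (w i : ℝ)) (fun b => (b i : ℝ)) (fun c => (c i : ℝ))
    beta_reduce at h2
    rw [h2, hML i, hMR i, hMQ e i]
  have hD : ∀ e : Fin d → ℤ,
      ∑' w, ∑' b, ∑' c, (∑ i, ((w i : ℝ)) ^ 2 + ∑ i, ((b i : ℝ)) ^ 2 + ∑ i, ((c i : ℝ)) ^ 2)
        * ((gL (w + r₀) * gL w) * (g (b + (s - e)) * g b) * (gR (c + -(r₀ + s)) * gR c))
      = ∑ i, ((∑' w, (w i : ℝ) ^ 2 * (gL (w + r₀) * gL w)) * (∑' b, g (b + (s - e)) * g b)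
            * (∑' c, gR (c + -(r₀ + s)) * gR c)
          + (∑' w, gL (w + r₀) * gL w) * (∑' b, (b i : ℝ) ^ 2 * (g (b + (s - e)) * g b))
            * (∑' c, gR (c + -(r₀ + s)) * gR c)
          + (∑' w, gL (w + r₀) * gL w) * (∑' b, g (b + (s - e)) * g b)
            * (∑' c, (c i : ℝ) ^ 2 * (gR (c + -(r₀ + s)) * gR c))) := by
    intro e
    have hsm : ∀ w b c : Fin d → ℤ, (∑ i, ((w i : ℝ)) ^ 2 + ∑ i, ((b i : ℝ)) ^ 2 + ∑ i, ((c i : ℝ)) ^ 2)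
        = ∑ i, (((w i : ℝ)) ^ 2 + ((b i : ℝ)) ^ 2 + ((c i : ℝ)) ^ 2) := by
      intro w b c; rw [← Finset.sum_add_distrib, ← Finset.sum_add_distrib]
    simp_rw [hsm]
    have h1 := tsum3_finset_sum Finset.univ (fun w => gL (w + r₀) * gL w) (fun b => g (b + (s - e)) * g b)
      (fun c => gR (c + -(r₀ + s)) * gR c) hLs (hQs e) hRs
      (fun (i : Fin d) (w b c : Fin d → ℤ) => ((w i : ℝ)) ^ 2 + ((b i : ℝ)) ^ 2 + ((c i : ℝ)) ^ 2)
    beta_reduce at h1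
    rw [h1]
    refine Finset.sum_congr rfl fun i _ => ?_
    have h2 := tsum3_diag_expand (fun w => gL (w + r₀) * gL w) (fun b => g (b + (s - e)) * g b)
      (fun c => gR (c + -(r₀ + s)) * gR c) hLs (hQs e) hRs (fun w => (w i : ℝ)) (fun b => (b i : ℝ)) (fun c => (c i : ℝ))
    beta_reduce at h2
    rw [h2]
  -- the difference, e by e
  have hdiff : ∀ e : Fin d → ℤ,
      ∑' w, ∑' b, ∑' c, (∑ i, ((w i : ℝ) + (b i : ℝ) + (c i : ℝ)) ^ 2)
        * ((gL (w + r₀) * gL w) * (g (b + (s - e)) * g b) * (gR (c + -(r₀ + s)) * gR c))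
      = ∑' w, ∑' b, ∑' c, (∑ i, ((w i : ℝ)) ^ 2 + ∑ i, ((b i : ℝ)) ^ 2 + ∑ i, ((c i : ℝ)) ^ 2)
          * ((gL (w + r₀) * gL w) * (g (b + (s - e)) * g b) * (gR (c + -(r₀ + s)) * gR c))
        + ((∑' w, gL (w + r₀) * gL w) * (∑' c, gR (c + -(r₀ + s)) * gR c) / 2)
          * ((∑' b, g (b + (s - e)) * g b)
            * ((-(∑ i, ((r₀ i : ℝ)) ^ 2) - ∑ i, ((s i : ℝ)) ^ 2 - ∑ i, (r₀ i : ℝ) * (s i : ℝ))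
              + ∑ i, (s i : ℝ) * (e i : ℝ))) := by
    intro e
    rw [hT e, hD e]
    have hi : (-(∑ i, ((r₀ i : ℝ)) ^ 2) - ∑ i, ((s i : ℝ)) ^ 2 - ∑ i, (r₀ i : ℝ) * (s i : ℝ))
          + ∑ i, (s i : ℝ) * (e i : ℝ)
        = ∑ i, (-((r₀ i : ℝ)) ^ 2 - ((s i : ℝ)) ^ 2 - (r₀ i : ℝ) * (s i : ℝ) + (s i : ℝ) * (e i : ℝ)) := by
      simp only [Finset.sum_add_distrib, Finset.sum_sub_distrib, Finset.sum_neg_distrib]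
    rw [hi, Finset.mul_sum, Finset.mul_sum, ← Finset.sum_add_distrib]
    refine Finset.sum_congr rfl fun i _ => ?_
    ring
  -- sum over the bond `e` with weights `κ` and collect the cross term
  have key : ∑ e ∈ E, κ e * ∑' w, ∑' b, ∑' c, (∑ i, ((w i : ℝ) + (b i : ℝ) + (c i : ℝ)) ^ 2)
        * ((gL (w + r₀) * gL w) * (g (b + (s - e)) * g b) * (gR (c + -(r₀ + s)) * gR c))
      = ∑ e ∈ E, κ e * ∑' w, ∑' b, ∑' c, (∑ i, ((w i : ℝ)) ^ 2 + ∑ i, ((b i : ℝ)) ^ 2 + ∑ i, ((c i : ℝ)) ^ 2)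
          * ((gL (w + r₀) * gL w) * (g (b + (s - e)) * g b) * (gR (c + -(r₀ + s)) * gR c))
        + ((∑' w, gL (w + r₀) * gL w) * (∑' c, gR (c + -(r₀ + s)) * gR c) / 2)
          * ((∑ e ∈ E, κ e * ∑' b, g (b + (s - e)) * g b)
              * ((-(∑ i, ((r₀ i : ℝ)) ^ 2) - ∑ i, ((s i : ℝ)) ^ 2 - ∑ i, (r₀ i : ℝ) * (s i : ℝ)))
            + ∑ i, (s i : ℝ) * (∑ e ∈ E, κ e * (∑' b, g (b + (s - e)) * g b) * (e i : ℝ))) := by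
    simp_rw [hdiff, mul_add, Finset.sum_add_distrib]
    congr 1
    have hN : ∑ i, (s i : ℝ) * (∑ e ∈ E, κ e * (∑' b, g (b + (s - e)) * g b) * (e i : ℝ))
        = ∑ e ∈ E, κ e * (∑' b, g (b + (s - e)) * g b) * ∑ i, (s i : ℝ) * (e i : ℝ) := by
      simp_rw [Finset.mul_sum]
      rw [Finset.sum_comm]
      exact Finset.sum_congr rfl fun e _ => Finset.sum_congr rfl fun i _ => by ring
    rw [hN, Finset.sum_mul, Finset.mul_sum, Finset.mul_sum, ← Finset.sum_add_distrib, ← Finset.sum_add_distrib]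
    exact Finset.sum_congr rfl fun e _ => by ring
  -- the sign lemma (layer B1) and the conclusion
  have hcross := cross_sign_le_zero E hE κ (fun q => ∑' b, g (b + q) * g b) hκ hA0 r₀ s
  beta_reduce at hcross
  have hfac : 0 ≤ (∑' w, gL (w + r₀) * gL w) * (∑' c, gR (c + -(r₀ + s)) * gR c) / 2 := by positivity
  rw [key]
  nlinarith [mul_nonpos_iff.mpr (Or.inl ⟨hfac, hcross⟩)]

end Summit.CriticalPhenomena.LaceExpansionHighD.WeightSplit

end
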